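import Mathlib
import HarnessLib
import Summits.Ventures.LatticeQCDFlow.Scaling.AutoregressivePathFaithful

/-!
# LatticeQCDFlow / Scaling — faithfulness through the block, DRESSED form: the path factor may read
# retained coordinates (the form every `d ≥ 2` application needs), and blindness is only tested on
# configurations differing at the far end `j`

HONEST FRAMING: exact (Metropolis-corrected) sampling algorithms for lattice gauge theory;
figures of merit are autocorrelation/cost numbers at stated couplings and volumes; no
continuum-physics claim.

Venture `LatticeQCDFlow` (cell pub-lqcd), topic `Scaling`, FANOUT row 30 (lean-1, GEN-17) — OUR WORK,
a sharpening of `Scaling/AutoregressivePathFaithful` §1 for THEORY-2 §4 C5 in `d ≥ 2`.  There the path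
factor `f₀` had to read only `{a, j} ∪ T`; on a lattice in `d ≥ 2` every integrated path site also has
RETAINED neighbours, whose bonds dress the path factor with one-body terms depending on the retained
configuration.  The proof of the product-form theorem never used more than "inside the block, `f₀` and
`w₁` read disjoint coordinates", and it only ever tested blindness on the four configurations
`φ[a ↦ v][j ↦ r]`:

* §1 **`dressedPath_productForm_of_blind`** — `w = f₀ · w₁ · w₂`, `f₀` reading ANY `V₀` with
  `(V₀ ∩ s) ∩ V₁ = ∅`, `w₁` reading `V₁ ∌ j`, `w₂` reading `V₂ ∌ a` with `V₂ ∩ s = ∅`, non-vanishing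
  as before; IF the exact conditional `A_s w / A_{insert a s} w` takes the same value at `φ[a↦v][j↦r]`
  and `φ[a↦v][j↦r']` for all `v, r, r'` (blindness to `j` ALONG THE FIBRE of `φ`), THEN the composed
  kernel `K(v,r) = A_s f₀(φ[a↦v][j↦r])` is of product form.  Contrapositive
  **`arConditional_reads_dressedPath`**: a non-product composed kernel gives `v, r, r'` with different
  conditionals at two configurations that differ ONLY at `j`.
* §2 `coordAvg_congr_fibre` — `A_s f₀ ψ = A_s f₀' ψ` whenever `f₀` and `f₀'` agree on the
  `s`-resamplings of `ψ`: along the fibre of `φ` the dressed path factor IS an honest path factor with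
  site weights `g_p(x)·∏_q b_{pq}(x, φ_q)` (`q` the retained neighbours of `p`), so
  `Scaling/AutoregressivePathFaithful.coordAvg_pathFactor` and
  `Scaling/KernelCompositionTP2.pathKernel_not_productForm` apply verbatim (the dressed site weights
  are positive bounded measurable when the bonds are).

READING (value-free, C5): the one-dimensional mechanism (a bond reached through an integrated PATH whose
interior has no other INTEGRATED neighbours is read) holds in every dimension — e.g. the first steps of
a row-by-row autoregressive sampler of a 2-d ferromagnetic field read the far end of the row through the
ungenerated segment; what remains open in `d ≥ 2` is the case where the integrated block touching the
path is not a path (STATUS 'For a successor').  NOT CLAIMED: that instance typed; any number of ours.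
Elementary over the parent; no `def`; nothing is cited as a fact; no `sorry`.
-/

noncomputable section

namespace Summit.Ventures.LatticeQCDFlow.Theory2.Autoregressive

open MeasureTheory Function Set
open Summit.Ventures.LatticeQCDFlow.Exactness

variable {ι : Type*} [Fintype ι] [DecidableEq ι]
variable {X : Type*} [MeasurableSpace X]
variable (μ : Measure X) [IsProbabilityMeasure μ]

/-! ## §1 The dressed sorting: blind along the fibre ⇒ composed kernel of product form -/

/-- **BLIND ALONG THE FIBRE ⇒ THE COMPOSED KERNEL IS OF PRODUCT FORM (dressed sorting).**
`w = f₀ · w₁ · w₂`; `f₀` reads `V₀`, `w₁` reads `V₁`, no coordinate of `s` is read by both; `j ∉ V₁`;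
`w₂` reads `V₂ ∌ a` with `V₂ ∩ s = ∅`; `j ∉ s`, `j ≠ a` (`a ∉ s` is not even needed); non-vanishing of `w₂`, `A_s w₁`,
`A_{insert a s} w`.  If the conditional agrees at `φ[a↦v][j↦r]` and `φ[a↦v][j↦r']` for all `v, r, r'`,
then `K u t · K u' t' = K u t' · K u' t`, `K v r = A_s f₀ (φ[a ↦ v][j ↦ r])`. [ours] -/
theorem dressedPath_productForm_of_blind (s : Finset ι) {a j : ι} (hjs : j ∉ s) (hja : j ≠ a) {f₀ w₁ w₂ : (ι → X) → ℝ} {V₀ V₁ V₂ : Set ι}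
    (hf₀ : DependsOn f₀ V₀) (hV₀₁ : ∀ i ∈ s, i ∈ V₀ → i ∉ V₁)
    (hw₁ : DependsOn w₁ V₁) (hjV₁ : j ∉ V₁)
    (hw₂ : DependsOn w₂ V₂) (haV₂ : a ∉ V₂) (hsV₂ : ∀ i ∈ s, i ∉ V₂) (φ : ι → X) (u u' t t' : X)
    (hw₂ne : ∀ ψ, w₂ ψ ≠ 0) (hG : ∀ ψ, coordAvg μ s w₁ ψ ≠ 0)
    (hM : ∀ ψ, coordAvg μ (insert a s) (fun η => f₀ η * w₁ η * w₂ η) ψ ≠ 0)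
    (hblind : ∀ v r r' : X,
      coordAvg μ s (fun η => f₀ η * w₁ η * w₂ η) (update (update φ a v) j r) /
          coordAvg μ (insert a s) (fun η => f₀ η * w₁ η * w₂ η) (update (update φ a v) j r) =
        coordAvg μ s (fun η => f₀ η * w₁ η * w₂ η) (update (update φ a v) j r') /
          coordAvg μ (insert a s) (fun η => f₀ η * w₁ η * w₂ η) (update (update φ a v) j r')) :
    coordAvg μ s f₀ (update (update φ a u) j t) * coordAvg μ s f₀ (update (update φ a u') j t') =
      coordAvg μ s f₀ (update (update φ a u) j t') * coordAvg μ s f₀ (update (update φ a u') j t) := by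
  classical
  -- the four test configurations `φ[a ↦ v][j ↦ r]`
  let c : X → X → (ι → X) := fun v r => update (update φ a v) j r
  have hcdef : ∀ v r, update (update φ a v) j r = c v r := fun v r => rfl
  simp only [hcdef]
  -- numerator: `w₂` comes out of `A_s`; `f₀` and `w₁` read disjoint parts of `s`
  have hnum : ∀ v r, coordAvg μ s (fun η => f₀ η * w₁ η * w₂ η) (c v r) =
      w₂ (c v r) * (coordAvg μ s f₀ (c v r) * coordAvg μ s w₁ (c v r)) := by
    intro v r
    have h1 : (fun η : ι → X => f₀ η * w₁ η * w₂ η) = fun η => w₂ η * (f₀ η * w₁ η) := by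
      funext η; ring
    rw [h1, coordAvg_mul_left μ s (Φ := w₂) (H := fun η => f₀ η * w₁ η) ?_ (c v r),
      coordAvg_mul_of_disjoint_reads μ s hf₀ hw₁ ?_ (c v r)]
    · intro i hi hif hiV
      exact hV₀₁ i hi hif hiV
    · intro ω ω'
      exact hw₂ fun i hi => Finset.piecewise_eq_of_notMem _ _ _ fun his => hsV₂ i his hi
  -- `A_s w₁` does not read `j`; `w₂` does not read `a`; the denominator does not read `a`
  have hGj : ∀ v r r', coordAvg μ s w₁ (c v r) = coordAvg μ s w₁ (c v r') := by
    intro v r r'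
    refine coordAvg_congr_of_dependsOn μ s hw₁ fun i hi _ => ?_
    have hij : i ≠ j := fun h => hjV₁ (h ▸ hi)
    simp [c, update_of_ne hij]
  have hHa : ∀ v v' r, w₂ (c v r) = w₂ (c v' r) := by
    intro v v' r
    refine hw₂ fun i hi => ?_
    have hia : i ≠ a := fun h => haV₂ (h ▸ hi)
    by_cases hij : i = j
    · subst hij; simp [c]
    · simp [c, update_of_ne hij, update_of_ne hia]
  have hMa : ∀ v v' r, coordAvg μ (insert a s) (fun η => f₀ η * w₁ η * w₂ η) (c v r) =
      coordAvg μ (insert a s) (fun η => f₀ η * w₁ η * w₂ η) (c v' r) := by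
    intro v v' r
    refine coordAvg_congr_of_dependsOn μ (insert a s) (V := Set.univ)
      (fun x y h => by rw [show x = y from funext fun i => h i (Set.mem_univ i)]) fun i _ hi => ?_
    have hia : i ≠ a := fun h => hi (h ▸ Finset.mem_insert_self a s)
    by_cases hij : i = j
    · subst hij; simp [c]
    · simp [c, update_of_ne hij, update_of_ne hia]
  -- blindness on the pairs `(c v t, c v t')`
  have hbl : ∀ v, coordAvg μ s (fun η => f₀ η * w₁ η * w₂ η) (c v t) /
      coordAvg μ (insert a s) (fun η => f₀ η * w₁ η * w₂ η) (c v t) =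
      coordAvg μ s (fun η => f₀ η * w₁ η * w₂ η) (c v t') /
      coordAvg μ (insert a s) (fun η => f₀ η * w₁ η * w₂ η) (c v t') := fun v => hblind v t t'
  have e1 := hbl u
  have e2 := hbl u'
  rw [hnum, hnum] at e1 e2
  set K₁ := coordAvg μ s f₀ (c u t)
  set K₂ := coordAvg μ s f₀ (c u t')
  set K₃ := coordAvg μ s f₀ (c u' t)
  set K₄ := coordAvg μ s f₀ (c u' t')
  set G := coordAvg μ s w₁ (c u t) with hGdef
  set G' := coordAvg μ s w₁ (c u' t) with hG'def
  set H := w₂ (c u t) with hHdef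
  set H' := w₂ (c u t') with hH'def
  set M := coordAvg μ (insert a s) (fun η => f₀ η * w₁ η * w₂ η) (c u t) with hMdef
  set M' := coordAvg μ (insert a s) (fun η => f₀ η * w₁ η * w₂ η) (c u t') with hM'def
  rw [← hGj u t t', ← hGdef] at e1
  rw [hHa u' u t, ← hHdef, hHa u' u t', ← hH'def, ← hGj u' t t', ← hG'def, hMa u' u t, ← hMdef,
    hMa u' u t', ← hM'def] at e2
  -- e1 : H * (K₁ * G) / M = H' * (K₂ * G) / M' ;  e2 : H * (K₃ * G') / M = H' * (K₄ * G') / M'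
  have hMne : M ≠ 0 := hM _
  have hM'ne : M' ≠ 0 := hM _
  rw [div_eq_div_iff hMne hM'ne] at e1 e2
  have e1' : K₁ * (H * M') = K₂ * (H' * M) := mul_right_cancel₀ (hG _) (by linear_combination e1)
  have e2' : K₃ * (H * M') = K₄ * (H' * M) := mul_right_cancel₀ (hG _) (by linear_combination e2)
  have hα : H * M' ≠ 0 := mul_ne_zero (hw₂ne _) hM'ne
  exact mul_right_cancel₀ hα (by linear_combination K₄ * e1' - K₂ * e2')


/-- **A DRESSED COMPOSED KERNEL THAT IS NOT OF PRODUCT FORM IS READ, by two configurations differing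
ONLY at `j`** (contrapositive of `dressedPath_productForm_of_blind`). [ours] -/
theorem arConditional_reads_dressedPath (s : Finset ι) {a j : ι} (hjs : j ∉ s) (hja : j ≠ a) {f₀ w₁ w₂ : (ι → X) → ℝ} {V₀ V₁ V₂ : Set ι}
    (hf₀ : DependsOn f₀ V₀) (hV₀₁ : ∀ i ∈ s, i ∈ V₀ → i ∉ V₁)
    (hw₁ : DependsOn w₁ V₁) (hjV₁ : j ∉ V₁)
    (hw₂ : DependsOn w₂ V₂) (haV₂ : a ∉ V₂) (hsV₂ : ∀ i ∈ s, i ∉ V₂)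
    (hw₂ne : ∀ ψ, w₂ ψ ≠ 0) (hG : ∀ ψ, coordAvg μ s w₁ ψ ≠ 0)
    (hM : ∀ ψ, coordAvg μ (insert a s) (fun η => f₀ η * w₁ η * w₂ η) ψ ≠ 0) (φ : ι → X)
    {u u' t t' : X}
    (hK : coordAvg μ s f₀ (update (update φ a u) j t) * coordAvg μ s f₀ (update (update φ a u') j t') ≠
      coordAvg μ s f₀ (update (update φ a u) j t') * coordAvg μ s f₀ (update (update φ a u') j t)) :
    ∃ v r r' : X,
      coordAvg μ s (fun η => f₀ η * w₁ η * w₂ η) (update (update φ a v) j r) /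
          coordAvg μ (insert a s) (fun η => f₀ η * w₁ η * w₂ η) (update (update φ a v) j r) ≠
        coordAvg μ s (fun η => f₀ η * w₁ η * w₂ η) (update (update φ a v) j r') /
          coordAvg μ (insert a s) (fun η => f₀ η * w₁ η * w₂ η) (update (update φ a v) j r') := by
  by_contra hcon
  push Not at hcon
  exact hK (dressedPath_productForm_of_blind μ s hjs hja hf₀ hV₀₁ hw₁ hjV₁ hw₂ haV₂ hsV₂ φ
    u u' t t' hw₂ne hG hM fun v r r' => hcon v r r')

/-! ## §2 Along the fibre the dressed path factor is an honest path factor -/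

omit [IsProbabilityMeasure μ] in
/-- **Fibre congruence of partial averages**: if `f₀` and `f₀'` agree on every `s`-resampling of `ψ`,
their partial averages agree at `ψ` (so a path factor dressed by bonds to retained sites, evaluated
along the fibre of `φ`, may be replaced by the path factor with the dressed one-body weights
`g_p(x)·∏_q b_{pq}(x, φ_q)`). [ours] -/
theorem coordAvg_congr_fibre (s : Finset ι) {f₀ f₀' : (ι → X) → ℝ} (ψ : ι → X)
    (h : ∀ ω' : ι → X, f₀ (s.piecewise ω' ψ) = f₀' (s.piecewise ω' ψ)) :
    coordAvg μ s f₀ ψ = coordAvg μ s f₀' ψ := by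
  unfold coordAvg
  exact integral_congr_ae (ae_of_all _ fun ω' => h ω')

omit [Fintype ι] [MeasurableSpace X] in
/-- The resamplings of `φ[a ↦ v][j ↦ r]` along `s` agree with `φ` at every coordinate off
`s ∪ {a, j}` — the retained coordinates that dress the path factor are FIXED along the fibre. [ours] -/
theorem piecewise_update_update_apply_of_not_mem (s : Finset ι) (φ ω' : ι → X) {a j i : ι}
    (his : i ∉ s) (hia : i ≠ a) (hij : i ≠ j) (v r : X) :
    s.piecewise ω' (update (update φ a v) j r) i = φ i := by
  rw [Finset.piecewise_eq_of_notMem _ _ _ his, update_of_ne hij, update_of_ne hia]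

end Summit.Ventures.LatticeQCDFlow.Theory2.Autoregressive

end
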